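import Mathlib.Combinatorics.SimpleGraph.Acyclic
import Mathlib.Combinatorics.SimpleGraph.Finite
import Mathlib.Topology.Algebra.InfiniteSum.ENNReal
import HarnessLib

/-!
# Effective resistance and effective conductance of a network; discrete extremal length

A *network* is a simple graph `G : SimpleGraph V` together with conductances
`c : Sym2 V → ℝ≥0` on unordered pairs (only the values on `G.edgeSet` matter; unit conductances
are `c = 1`, the case of finite subgraphs of `ℤ²` such as `discreteDomainGraph Ω δ` of
`DomainDiscretisation.lean`). For a potential `v : V → ℝ` its Dirichlet energy is
`networkEnergy G c v = Σ_{e ∈ E(G)} c(e) (dv(e))²` (an `ℝ≥0∞`-valued `tsum`, so that graphs on an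
infinite vertex type with finitely many edges need no finiteness bookkeeping), and for two vertex
sets `A Z : Set V`

* `effectiveConductance G c A Z = 𝒞(A ↔ Z) := inf { energy(v) : v ≡ 1 on A, v ≡ 0 on Z }`
  (Dirichlet's principle, Lyons–Peres 2016, §2.4, Exercise 2.13, taken as the definition);
* `effectiveResistance G c A Z = ℛ(A ↔ Z) := 𝒞(A ↔ Z)⁻¹`.

Both live in `ℝ≥0∞`; the conventions forced by `⨅`/`⁻¹` are the standard ones:
`A ∩ Z ≠ ∅` gives `𝒞 = ⊤, ℛ = 0` (no admissible potential), `A = ∅`, `Z = ∅` or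
"no path from `A` to `Z`" give `𝒞 = 0, ℛ = ⊤`. For a finite network this is the effective
conductance/resistance of Lyons–Peres 2016, §2.2 (defined there through the voltage `v` and the
current `i`, `𝒞(a ↔ Z) = π(a) P[a → Z]`, and identified with the Dirichlet minimum in
Exercise 2.13) and of Grimmett 2018, §1.3 (`R_eff = 1/W_eff`, Lemma 1.25).

Proved here: the Dirichlet upper bound, symmetry in `(A, Z)`, the junk values above, the series
upper bound `effectiveResistance_le_sum_inv` (`ℛ(A ↔ Z) ≤ Σ_{e ∈ p} 1/c(e)` along any walk
without repeated edges from `A` to `Z`, by Cauchy–Schwarz; hence `ℛ < ⊤`, `𝒞 > 0` on connected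
finite networks),
*Rayleigh's monotonicity principle* (Lyons–Peres 2016, §2.4, p. 35: `c ≤ c'` implies
`𝒞_c ≤ 𝒞_{c'}`, and adding edges increases `𝒞`), which is immediate from Dirichlet's principle
(Lyons–Peres 2016, Exercise 2.76), and *Duffin's theorem* `extremalLength_eq_effectiveResistance`:
the discrete extremal length
`EL(A, Z) = sup_W dist_W(A, Z)² / Σ_e c(e) W(e)²` over edge lengths `W : Sym2 V → ℝ≥0`
(Duffin 1962; Lyons–Peres 2016, Exercise 2.78) equals `ℛ(A ↔ Z)` — for every simple graph and
all `A, Z`, with the `ℝ≥0∞` conventions above — together with the form printed in Exercise 2.78,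
`effectiveConductance_eq_iInf_networkArea` (`𝒞(A ↔ Z) = inf Σ_e c(e) ℓ(e)²` over `ℓ ≥ 0` with
`dist_ℓ(A, Z) ≥ 1`).

Vendored as ONE named fact (not proved here; it needs the matrix–tree theorem or Wilson's
algorithm, which Mathlib lacks — Mathlib has `SimpleGraph.lapMatrix` but neither spanning-tree
counts nor effective resistance): *Kirchhoff's effective resistance formula*
`KirchhoffEdgeFormula` (Lyons–Peres 2016, §4.2: `P[e ∈ T] = c(e) ℛ(e⁻ ↔ e⁺)` for the weighted
uniform spanning tree `T` of a finite connected network, written out as a ratio of spanning-tree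
weights). Its classical corollary `KirchhoffEdgeFormula.forestRatio` (Bondy–Murty 2008,
Theorem 20.22 and its proof: `r_xy = t(G/{x,y}) / t(G)`, i.e. effective resistance =
#spanning 2-forests separating `x` from `y` / #spanning trees, unit conductances) is DERIVED
here from the named fact, following that proof (auxiliary unit conductor between `x` and `y`,
the bijection `T ↦ T - xy` between spanning trees through `xy` and separating 2-forests —
`isTree_fromEdgeSet_insert_iff` — and the parallel law `effectiveConductance_add_unit_conductor`).

Deliberately NOT here: flows and Thomson's principle, random-walk interpretations
(escape probabilities, commute times), resistance to infinity and the free/wired distinction on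
infinite networks (the definitions below make sense for any `SimpleGraph`, but for an infinite
network the infimum over *all* potentials is only one of the candidates of Lyons–Peres 2016, §9,
and nothing is claimed about it beyond what is proved in this file), series/parallel/contraction
laws as separate statements (parallel edges do not exist in a simple graph; conductances add
instead), the uniform spanning tree measure itself, and the matrix–tree theorem.

## References

* [LyonsPeres2016] R. Lyons, Y. Peres, *Probability on Trees and Networks*, CUP 2016,
  §2.2 (effective conductance (2.4)–(2.5)), §2.4 (energy, Rayleigh, Exercise 2.13 = Dirichlet's
  principle), Chapter 2 Additional Exercises 2.76, 2.78 (extremal length), §4.2 (Kirchhoff's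
  effective resistance formula).
* [Duffin1962] R. J. Duffin, *The extremal length of a network*, J. Math. Anal. Appl. 5 (1962)
  200–215 (the identity of Exercise 2.78; source of the name `extremalLength`).
* [BondyMurty2008] J. A. Bondy, U. S. R. Murty, *Graph Theory*, GTM 244, Springer 2008,
  Chapter 20, Theorem 20.22 (`r_xy = t(G/{x,y})/t(G)`).
* [Grimmett2018] G. Grimmett, *Probability on Graphs*, 2nd ed., CUP 2018, §1.3 (Theorem 1.16,
  Lemma 1.25, Theorem 1.29 = Rayleigh principle).
-/

namespace Literature.Probability.LatticeModels

open scoped ENNReal NNReal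
open SimpleGraph

noncomputable section

variable {V : Type*}

/-! ### Increments of a potential across an unordered pair -/

/-- The squared increment `(v x - v y)²` of a potential `v : V → ℝ` across the unordered pair
`s(x, y)`; it is symmetric in `x, y`, hence a function on `Sym2 V` (`dv(e)²` in the notation of
Lyons–Peres 2016, §2.4). [folklore] -/
def sqIncr (v : V → ℝ) : Sym2 V → ℝ :=
  Sym2.lift ⟨fun x y ↦ (v x - v y) ^ 2, fun x y ↦ by ring⟩

/-- `sqIncr` on a concrete pair. [folklore] -/
@[simp] theorem sqIncr_mk (v : V → ℝ) (x y : V) : sqIncr v s(x, y) = (v x - v y) ^ 2 := rfl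

/-- Squared increments are nonnegative. [folklore] -/
theorem sqIncr_nonneg (v : V → ℝ) (e : Sym2 V) : 0 ≤ sqIncr v e :=
  Sym2.ind (fun x y ↦ by rw [sqIncr_mk]; positivity) e

/-- A constant potential has no increments. [folklore] -/
@[simp] theorem sqIncr_const (a : ℝ) : sqIncr (fun _ : V ↦ a) = 0 := by
  funext e
  exact Sym2.ind (fun x y ↦ by simp) e

/-- `v ↦ a - v` does not change squared increments. [folklore] -/
@[simp] theorem sqIncr_const_sub (a : ℝ) (v : V → ℝ) :
    sqIncr (fun x ↦ a - v x) = sqIncr v := by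
  funext e
  exact Sym2.ind (fun x y ↦ by simp only [sqIncr_mk]; ring) e

/-- The absolute increment `|v x - v y|` of a potential across `s(x, y)`, as an `ℝ≥0`-valued
edge-length function (`|dv(e)|`). [folklore] -/
def absIncr (v : V → ℝ) : Sym2 V → ℝ≥0 :=
  Sym2.lift ⟨fun x y ↦ Real.nnabs (v x - v y), fun x y ↦ by ext; simp [abs_sub_comm]⟩

/-- `absIncr` on a concrete pair. [folklore] -/
@[simp] theorem coe_absIncr_mk (v : V → ℝ) (x y : V) :
    (absIncr v s(x, y) : ℝ) = |v x - v y| := by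
  simp [absIncr]

/-- `|dv(e)|² = dv(e)²`, in `ℝ≥0∞`. [folklore] -/
theorem coe_absIncr_sq (v : V → ℝ) (e : Sym2 V) :
    ((absIncr v e : ℝ≥0) : ℝ≥0∞) ^ 2 = ENNReal.ofReal (sqIncr v e) := by
  refine Sym2.ind (fun x y ↦ ?_) e
  rw [sqIncr_mk, ← sq_abs, ENNReal.ofReal_pow (abs_nonneg _), ← coe_absIncr_mk,
    ENNReal.ofReal_coe_nnreal]

/-! ### Dirichlet energy of a potential -/

/-- The Dirichlet energy `Σ_{e ∈ E(G)} c(e) (dv(e))²` of a potential `v : V → ℝ` on the network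
`(G, c)` (Lyons–Peres 2016, §2.4, the quantity minimised in Exercise 2.13), as an `ℝ≥0∞`-valued
sum over the edge set; pairs outside `G.edgeSet` do not contribute, so only `c` restricted to the
edges matters. [cite: LyonsPeres2016, §2.4, Exercise 2.13] -/
def networkEnergy (G : SimpleGraph V) (c : Sym2 V → ℝ≥0) (v : V → ℝ) : ℝ≥0∞ :=
  ∑' e, G.edgeSet.indicator (fun e ↦ (c e : ℝ≥0∞) * ENNReal.ofReal (sqIncr v e)) e

section Energy

variable {G G' : SimpleGraph V} {c c' : Sym2 V → ℝ≥0}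

/-- On a graph with finitely many edges the energy is the finite sum over `G.edgeFinset`.
[folklore] -/
theorem networkEnergy_eq_sum (G : SimpleGraph V) [Fintype G.edgeSet] (c : Sym2 V → ℝ≥0)
    (v : V → ℝ) :
    networkEnergy G c v = ∑ e ∈ G.edgeFinset, (c e : ℝ≥0∞) * ENNReal.ofReal (sqIncr v e) := by
  have h0 : ∀ e ∉ G.edgeFinset,
      G.edgeSet.indicator (fun e ↦ (c e : ℝ≥0∞) * ENNReal.ofReal (sqIncr v e)) e = 0 :=
    fun e he ↦ Set.indicator_apply_eq_zero.2 fun h ↦ (he (mem_edgeFinset.2 h)).elim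
  rw [networkEnergy, tsum_eq_sum h0]
  exact Finset.sum_congr rfl fun e he ↦ Set.indicator_of_mem (mem_edgeFinset.1 he) _

/-- On a graph with finitely many edges every potential has finite energy. [folklore] -/
theorem networkEnergy_lt_top (G : SimpleGraph V) [Fintype G.edgeSet] (c : Sym2 V → ℝ≥0)
    (v : V → ℝ) : networkEnergy G c v < ∞ := by
  rw [networkEnergy_eq_sum]
  exact ENNReal.sum_lt_top.2 fun e _ ↦ ENNReal.mul_lt_top ENNReal.coe_lt_top ENNReal.ofReal_lt_top

/-- The energy is monotone in the conductances (termwise). [folklore] -/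
theorem networkEnergy_mono_conductance (G : SimpleGraph V) (h : c ≤ c') (v : V → ℝ) :
    networkEnergy G c v ≤ networkEnergy G c' v :=
  ENNReal.tsum_le_tsum fun e ↦ Set.indicator_le_indicator <|
    mul_le_mul_left (ENNReal.coe_le_coe.2 (h e)) _

/-- The energy is monotone in the graph: more edges, more terms. [folklore] -/
theorem networkEnergy_mono_graph (c : Sym2 V → ℝ≥0) (h : G ≤ G') (v : V → ℝ) :
    networkEnergy G c v ≤ networkEnergy G' c v :=
  ENNReal.tsum_le_tsum fun _ ↦
    Set.indicator_le_indicator_of_subset (edgeSet_mono h) (fun _ ↦ zero_le) _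

/-- A potential that is constant across every edge has zero energy. [folklore] -/
theorem networkEnergy_eq_zero_of_adj {v : V → ℝ} (h : ∀ ⦃x y : V⦄, G.Adj x y → v x = v y) :
    networkEnergy G c v = 0 := by
  refine ENNReal.tsum_eq_zero.2 (Sym2.ind fun x y ↦ Set.indicator_apply_eq_zero.2 fun hxy ↦ ?_)
  simp [h ((mem_edgeSet G).1 hxy)]

/-- Constant potentials have zero energy. [folklore] -/
@[simp] theorem networkEnergy_const (a : ℝ) : networkEnergy G c (fun _ ↦ a) = 0 :=
  networkEnergy_eq_zero_of_adj fun _ _ _ ↦ rfl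

/-- `v ↦ a - v` preserves the energy. [folklore] -/
@[simp] theorem networkEnergy_const_sub (a : ℝ) (v : V → ℝ) :
    networkEnergy G c (fun x ↦ a - v x) = networkEnergy G c v := by
  simp only [networkEnergy, sqIncr_const_sub]

end Energy

/-! ### Effective conductance and effective resistance (Dirichlet's principle) -/

/-- The **effective conductance** `𝒞(A ↔ Z)` between two vertex sets of the network `(G, c)`,
defined by *Dirichlet's principle*: the infimum of the Dirichlet energy
`Σ_e c(e) dF(e)²` over all potentials `F : V → ℝ` with `F ≡ 1` on `A` and `F ≡ 0` on `Z`
(Lyons–Peres 2016, Exercise 2.13, where it is shown to agree, for a finite network and disjoint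
`A, Z`, with the definition `𝒞(A ↔ Z) = 1/ℛ(A ↔ Z)` of §2.2 via voltage and current).
Values in `ℝ≥0∞`; `A ∩ Z ≠ ∅` gives `⊤` (empty infimum), `A = ∅` or `Z = ∅` gives `0`.
[cite: LyonsPeres2016, §2.4, Exercise 2.13] -/
def effectiveConductance (G : SimpleGraph V) (c : Sym2 V → ℝ≥0) (A Z : Set V) : ℝ≥0∞ :=
  ⨅ (v : V → ℝ) (_ : A.EqOn v 1) (_ : Z.EqOn v 0), networkEnergy G c v

/-- The **effective resistance** `ℛ(A ↔ Z) := 𝒞(A ↔ Z)⁻¹` between two vertex sets of the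
network `(G, c)` (Lyons–Peres 2016, §2.2, "the reciprocal of the effective conductance"; by
Thomson's principle it is also the minimal energy of a unit flow from `A` to `Z`, Exercise 2.13,
not used here). Values in `ℝ≥0∞`: `A ∩ Z ≠ ∅` gives `0`, `A = ∅`, `Z = ∅` or `A, Z` not joined
by a path gives `⊤`. [cite: LyonsPeres2016, §2.2, eq. (2.4)–(2.5), and §2.4, Exercise 2.13] -/
def effectiveResistance (G : SimpleGraph V) (c : Sym2 V → ℝ≥0) (A Z : Set V) : ℝ≥0∞ :=
  (effectiveConductance G c A Z)⁻¹

section Dirichlet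

variable {G G' : SimpleGraph V} {c c' : Sym2 V → ℝ≥0} {A A' Z Z' : Set V}

/-- Unfolding lemma. [folklore] -/
theorem effectiveResistance_def (G : SimpleGraph V) (c : Sym2 V → ℝ≥0) (A Z : Set V) :
    effectiveResistance G c A Z = (effectiveConductance G c A Z)⁻¹ := rfl

/-- Unfolding lemma. [folklore] -/
@[simp] theorem effectiveResistance_inv (G : SimpleGraph V) (c : Sym2 V → ℝ≥0) (A Z : Set V) :
    (effectiveResistance G c A Z)⁻¹ = effectiveConductance G c A Z := inv_inv _

/-- **Dirichlet's principle**, inequality form: every admissible potential bounds the effective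
conductance from above. [cite: LyonsPeres2016, §2.4, Exercise 2.13] -/
theorem effectiveConductance_le_networkEnergy {v : V → ℝ} (hA : A.EqOn v 1) (hZ : Z.EqOn v 0) :
    effectiveConductance G c A Z ≤ networkEnergy G c v :=
  iInf_le_of_le v <| iInf_le_of_le hA <| iInf_le _ hZ

/-- Lower bounds on the effective conductance are lower bounds on all admissible energies.
[folklore] -/
theorem le_effectiveConductance {b : ℝ≥0∞}
    (h : ∀ v : V → ℝ, A.EqOn v 1 → Z.EqOn v 0 → b ≤ networkEnergy G c v) :
    b ≤ effectiveConductance G c A Z :=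
  le_iInf fun v ↦ le_iInf fun hA ↦ le_iInf fun hZ ↦ h v hA hZ

/-- If `A` and `Z` meet there is no admissible potential: `𝒞 = ⊤`. [folklore] -/
theorem effectiveConductance_of_not_disjoint (h : ¬ Disjoint A Z) :
    effectiveConductance G c A Z = ⊤ := by
  obtain ⟨x, hxA, hxZ⟩ := Set.not_disjoint_iff.1 h
  refine le_antisymm le_top (le_effectiveConductance fun v hA hZ ↦ ?_)
  have h1 := hA hxA
  have h0 := hZ hxZ
  simp only [Pi.one_apply, Pi.zero_apply] at h1 h0
  exact absurd (h1.symm.trans h0) one_ne_zero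

/-- If `A` and `Z` meet, `ℛ(A ↔ Z) = 0`. [folklore] -/
theorem effectiveResistance_of_not_disjoint (h : ¬ Disjoint A Z) :
    effectiveResistance G c A Z = 0 := by
  rw [effectiveResistance, effectiveConductance_of_not_disjoint h, ENNReal.inv_top]

/-- `𝒞(∅ ↔ Z) = 0` (the zero potential is admissible). [folklore] -/
@[simp] theorem effectiveConductance_empty_left (G : SimpleGraph V) (c : Sym2 V → ℝ≥0)
    (Z : Set V) : effectiveConductance G c ∅ Z = 0 :=
  le_antisymm ((effectiveConductance_le_networkEnergy (v := fun _ ↦ 0)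
    (Set.eqOn_empty _ _) (fun _ _ ↦ rfl)).trans_eq (networkEnergy_const 0)) zero_le

/-- `𝒞(A ↔ ∅) = 0` (the unit potential is admissible). [folklore] -/
@[simp] theorem effectiveConductance_empty_right (G : SimpleGraph V) (c : Sym2 V → ℝ≥0)
    (A : Set V) : effectiveConductance G c A ∅ = 0 :=
  le_antisymm ((effectiveConductance_le_networkEnergy (v := fun _ ↦ 1)
    (fun _ _ ↦ rfl) (Set.eqOn_empty _ _)).trans_eq (networkEnergy_const 1)) zero_le

/-- `ℛ(∅ ↔ Z) = ⊤`. [folklore] -/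
@[simp] theorem effectiveResistance_empty_left (G : SimpleGraph V) (c : Sym2 V → ℝ≥0)
    (Z : Set V) : effectiveResistance G c ∅ Z = ⊤ := by
  simp [effectiveResistance]

/-- `ℛ(A ↔ ∅) = ⊤`. [folklore] -/
@[simp] theorem effectiveResistance_empty_right (G : SimpleGraph V) (c : Sym2 V → ℝ≥0)
    (A : Set V) : effectiveResistance G c A ∅ = ⊤ := by
  simp [effectiveResistance]

/-- One half of the symmetry `𝒞(A ↔ Z) = 𝒞(Z ↔ A)`: `v ↦ 1 - v` exchanges the boundary
conditions and preserves the energy. [folklore] -/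
theorem effectiveConductance_comm_le (G : SimpleGraph V) (c : Sym2 V → ℝ≥0) (A Z : Set V) :
    effectiveConductance G c Z A ≤ effectiveConductance G c A Z :=
  le_effectiveConductance fun v hA hZ ↦
    (effectiveConductance_le_networkEnergy (v := fun x ↦ 1 - v x)
      (fun x hx ↦ by simp [hZ hx]) (fun x hx ↦ by simp [hA hx])).trans_eq
      (networkEnergy_const_sub 1 v)

/-- Symmetry `𝒞(A ↔ Z) = 𝒞(Z ↔ A)`. [folklore] -/
theorem effectiveConductance_comm (G : SimpleGraph V) (c : Sym2 V → ℝ≥0) (A Z : Set V) :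
    effectiveConductance G c A Z = effectiveConductance G c Z A :=
  le_antisymm (effectiveConductance_comm_le G c Z A) (effectiveConductance_comm_le G c A Z)

/-- Symmetry `ℛ(A ↔ Z) = ℛ(Z ↔ A)`. [folklore] -/
theorem effectiveResistance_comm (G : SimpleGraph V) (c : Sym2 V → ℝ≥0) (A Z : Set V) :
    effectiveResistance G c A Z = effectiveResistance G c Z A := by
  rw [effectiveResistance, effectiveConductance_comm, ← effectiveResistance]

/-- Enlarging `A` or `Z` (more boundary conditions) increases `𝒞`. [folklore] -/
theorem effectiveConductance_mono_sets (hA : A ⊆ A') (hZ : Z ⊆ Z') :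
    effectiveConductance G c A Z ≤ effectiveConductance G c A' Z' :=
  le_effectiveConductance fun _ hvA hvZ ↦
    effectiveConductance_le_networkEnergy (hvA.mono hA) (hvZ.mono hZ)

/-- **Rayleigh's monotonicity principle** (conductance form): `c ≤ c'` everywhere implies
`𝒞_c(A ↔ Z) ≤ 𝒞_{c'}(A ↔ Z)` (Lyons–Peres 2016, §2.4, p. 35, part (i); the proof from
Dirichlet's principle is their Exercise 2.76). [cite: LyonsPeres2016, §2.4, Rayleigh's Monotonicity Principle, p. 35] -/
theorem effectiveConductance_mono_conductance (G : SimpleGraph V) (h : c ≤ c') (A Z : Set V) :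
    effectiveConductance G c A Z ≤ effectiveConductance G c' A Z :=
  le_effectiveConductance fun v hA hZ ↦
    (effectiveConductance_le_networkEnergy hA hZ).trans (networkEnergy_mono_conductance G h v)

/-- **Rayleigh's monotonicity principle** (resistance form, Grimmett 2018, Theorem 1.29:
`R_eff` is non-decreasing in the edge resistances): `c ≤ c'` implies
`ℛ_{c'}(A ↔ Z) ≤ ℛ_c(A ↔ Z)`. [cite: LyonsPeres2016, §2.4, Rayleigh's Monotonicity Principle, p. 35] -/
theorem effectiveResistance_anti_conductance (G : SimpleGraph V) (h : c ≤ c') (A Z : Set V) :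
    effectiveResistance G c' A Z ≤ effectiveResistance G c A Z :=
  ENNReal.inv_le_inv.2 (effectiveConductance_mono_conductance G h A Z)

/-- Rayleigh monotonicity in the graph: adding edges increases the effective conductance
("removing an edge decreases effective conductance", Lyons–Peres 2016, §2.4).
[cite: LyonsPeres2016, §2.4, discussion after Rayleigh's Monotonicity Principle] -/
theorem effectiveConductance_mono_graph (c : Sym2 V → ℝ≥0) (h : G ≤ G') (A Z : Set V) :
    effectiveConductance G c A Z ≤ effectiveConductance G' c A Z :=
  le_effectiveConductance fun v hA hZ ↦
    (effectiveConductance_le_networkEnergy hA hZ).trans (networkEnergy_mono_graph c h v)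

/-- Rayleigh monotonicity in the graph, resistance form: removing edges increases the effective
resistance. [cite: LyonsPeres2016, §2.4, discussion after Rayleigh's Monotonicity Principle] -/
theorem effectiveResistance_anti_graph (c : Sym2 V → ℝ≥0) (h : G ≤ G') (A Z : Set V) :
    effectiveResistance G' c A Z ≤ effectiveResistance G c A Z :=
  ENNReal.inv_le_inv.2 (effectiveConductance_mono_graph c h A Z)

open Classical in
/-- If no vertex of `Z` can be reached from `A` in `G`, then `𝒞(A ↔ Z) = 0`: the indicator of
the set of vertices reachable from `A` is admissible and has zero energy. [folklore] -/
theorem effectiveConductance_eq_zero_of_not_reachable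
    (h : ∀ a ∈ A, ∀ z ∈ Z, ¬ G.Reachable a z) : effectiveConductance G c A Z = 0 := by
  set U : Set V := {x | ∃ a ∈ A, G.Reachable a x} with hU
  let v : V → ℝ := fun x ↦ if x ∈ U then 1 else 0
  have hA : A.EqOn v 1 := fun a ha ↦ by
    have : a ∈ U := ⟨a, ha, Reachable.refl a⟩
    simp [v, this]
  have hZ : Z.EqOn v 0 := fun z hz ↦ by
    have : z ∉ U := fun ⟨a, ha, haz⟩ ↦ h a ha z hz haz
    simp [v, this]
  refine le_antisymm ((effectiveConductance_le_networkEnergy hA hZ).trans_eq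
    (networkEnergy_eq_zero_of_adj fun x y hxy ↦ ?_)) zero_le
  have hiff : x ∈ U ↔ y ∈ U :=
    ⟨fun ⟨a, ha, hax⟩ ↦ ⟨a, ha, hax.trans hxy.reachable⟩,
      fun ⟨a, ha, hay⟩ ↦ ⟨a, ha, hay.trans hxy.symm.reachable⟩⟩
  by_cases hx : x ∈ U
  · simp [v, hx, hiff.1 hx]
  · simp [v, hx, mt hiff.2 hx]

/-- If no vertex of `Z` can be reached from `A` in `G`, then `ℛ(A ↔ Z) = ⊤`. [folklore] -/
theorem effectiveResistance_eq_top_of_not_reachable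
    (h : ∀ a ∈ A, ∀ z ∈ Z, ¬ G.Reachable a z) : effectiveResistance G c A Z = ⊤ := by
  rw [effectiveResistance, effectiveConductance_eq_zero_of_not_reachable h, ENNReal.inv_zero]

end Dirichlet

/-! ### Discrete extremal length (Duffin) -/

/-- The `W`-length `Σ_{e ∈ p} W(e)` of a walk for an assignment `W : Sym2 V → ℝ≥0` of lengths
to unordered pairs (edges counted with multiplicity along the walk). [folklore] -/
def walkLength {G : SimpleGraph V} (W : Sym2 V → ℝ≥0) {x y : V} (p : G.Walk x y) : ℝ≥0 :=
  (p.edges.map W).sum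

/-- The `W`-distance `dist_W(A, Z)` between two vertex sets: the infimum of the `W`-lengths of
walks of `G` from a vertex of `A` to a vertex of `Z` (`⊤` if there is none).
[folklore] -/
def edgeDist (G : SimpleGraph V) (W : Sym2 V → ℝ≥0) (A Z : Set V) : ℝ≥0∞ :=
  ⨅ (x : V) (_ : x ∈ A) (y : V) (_ : y ∈ Z) (p : G.Walk x y), (walkLength W p : ℝ≥0∞)

/-- The *area* `Σ_{e ∈ E(G)} c(e) W(e)²` of the length assignment `W` on the network `(G, c)`
(the quantity minimised in Lyons–Peres 2016, Exercise 2.78; with unit conductances it is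
`Σ_e W(e)²`). [cite: LyonsPeres2016, Chapter 2, Additional Exercises, Exercise 2.78] -/
def networkArea (G : SimpleGraph V) (c W : Sym2 V → ℝ≥0) : ℝ≥0∞ :=
  ∑' e, G.edgeSet.indicator (fun e ↦ (c e : ℝ≥0∞) * (W e : ℝ≥0∞) ^ 2) e

/-- The **discrete extremal length** of the family of paths joining `A` to `Z` in the network
`(G, c)`: `EL(A, Z) = sup_W dist_W(A, Z)² / Σ_e c(e) W(e)²` over all assignments of nonnegative
lengths `W` to the edges — the network analogue, due to Duffin (1962), of the Ahlfors–Beurling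
extremal length `sup_ρ L_ρ(Γ)² / A(ρ)`; Lyons–Peres 2016, Exercise 2.78, state the equivalent
normalised form "`𝒞(A ↔ Z) = min Σ_e c(e) ℓ(e)²` over `ℓ ≥ 0` with `dist_ℓ(A, Z) ≥ 1`".
`ℝ≥0∞` conventions for the quotient: `0 / y = 0` and `x / ⊤ = 0` for all `x, y` (so `W = 0`
contributes `0`), `x / 0 = ⊤` for `x ≠ 0`. [cite: LyonsPeres2016, Chapter 2, Additional Exercises, Exercise 2.78 (identity due to Duffin 1962)] -/
def extremalLength (G : SimpleGraph V) (c : Sym2 V → ℝ≥0) (A Z : Set V) : ℝ≥0∞ :=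
  ⨆ W : Sym2 V → ℝ≥0, edgeDist G W A Z ^ 2 / networkArea G c W

section Duffin

variable {G : SimpleGraph V} {c : Sym2 V → ℝ≥0} {A Z : Set V}

/-- [folklore] -/
@[simp] theorem walkLength_nil (W : Sym2 V → ℝ≥0) (x : V) :
    walkLength W (Walk.nil : G.Walk x x) = 0 := by
  simp [walkLength]

/-- [folklore] -/
@[simp] theorem walkLength_cons (W : Sym2 V → ℝ≥0) {x y z : V} (h : G.Adj x y)
    (p : G.Walk y z) : walkLength W (Walk.cons h p) = W s(x, y) + walkLength W p := by
  simp [walkLength]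

/-- [folklore] -/
@[simp] theorem walkLength_concat (W : Sym2 V → ℝ≥0) {x y z : V} (p : G.Walk x y)
    (h : G.Adj y z) : walkLength W (p.concat h) = walkLength W p + W s(y, z) := by
  simp [walkLength, Walk.edges_concat]

/-- The distance is at most the length of any walk from `A` to `Z`. [folklore] -/
theorem edgeDist_le_walkLength (W : Sym2 V → ℝ≥0) {x y : V} (hx : x ∈ A) (hy : y ∈ Z)
    (p : G.Walk x y) : edgeDist G W A Z ≤ walkLength W p :=
  iInf_le_of_le x <| iInf_le_of_le hx <| iInf_le_of_le y <| iInf_le_of_le hy <| iInf_le _ p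

/-- Lower bounds for the distance. [folklore] -/
theorem le_edgeDist {W : Sym2 V → ℝ≥0} {b : ℝ≥0∞}
    (h : ∀ x ∈ A, ∀ y ∈ Z, ∀ p : G.Walk x y, b ≤ walkLength W p) : b ≤ edgeDist G W A Z :=
  le_iInf fun x ↦ le_iInf fun hx ↦ le_iInf fun y ↦ le_iInf fun hy ↦ le_iInf fun p ↦ h x hx y hy p

/-- The area of the length assignment `|dv|` is the energy of `v`. [folklore] -/
theorem networkArea_absIncr (G : SimpleGraph V) (c : Sym2 V → ℝ≥0) (v : V → ℝ) :
    networkArea G c (absIncr v) = networkEnergy G c v := by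
  simp only [networkArea, networkEnergy, coe_absIncr_sq]

/-- Telescoping: along any walk, `|v(x) - v(y)| ≤ Σ_{e ∈ p} |dv(e)|`. [folklore] -/
theorem abs_sub_le_walkLength_absIncr (v : V → ℝ) {x y : V} (p : G.Walk x y) :
    |v x - v y| ≤ (walkLength (absIncr v) p : ℝ) := by
  induction p with
  | nil => simp
  | @cons a b _ h p ih =>
    rw [walkLength_cons, NNReal.coe_add, coe_absIncr_mk]
    exact (abs_sub_le (v a) (v b) _).trans (by gcongr)

/-- For an admissible potential `v` (`1` on `A`, `0` on `Z`) every walk from `A` to `Z` has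
`|dv|`-length at least `1`. [folklore] -/
theorem one_le_edgeDist_absIncr {v : V → ℝ} (hA : A.EqOn v 1) (hZ : Z.EqOn v 0) :
    1 ≤ edgeDist G (absIncr v) A Z := by
  refine le_edgeDist fun x hx y hy p ↦ ?_
  have h := abs_sub_le_walkLength_absIncr v p
  rw [hA hx, hZ hy, Pi.one_apply, Pi.zero_apply, sub_zero, abs_one] at h
  exact ENNReal.one_le_coe_iff.2 (NNReal.coe_le_coe.1 (by simpa using h))

/-- **Duffin's theorem, easy half**: `ℛ(A ↔ Z) ≤ EL(A, Z)` — test the supremum with the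
lengths `W = |dv|` of near-optimal potentials. [cite: LyonsPeres2016, Chapter 2, Additional Exercises, Exercise 2.78 (identity due to Duffin 1962)] -/
theorem effectiveResistance_le_extremalLength (G : SimpleGraph V) (c : Sym2 V → ℝ≥0)
    (A Z : Set V) : effectiveResistance G c A Z ≤ extremalLength G c A Z := by
  rw [effectiveResistance, effectiveConductance, ENNReal.inv_iInf]
  refine iSup_le fun v ↦ ?_
  rw [ENNReal.inv_iInf]
  refine iSup_le fun hA ↦ ?_
  rw [ENNReal.inv_iInf]
  refine iSup_le fun hZ ↦ ?_
  refine le_trans ?_ (le_iSup (fun W ↦ edgeDist G W A Z ^ 2 / networkArea G c W) (absIncr v))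
  rw [networkArea_absIncr, ENNReal.div_eq_inv_mul]
  calc (networkEnergy G c v)⁻¹ = (networkEnergy G c v)⁻¹ * 1 ^ 2 := by rw [one_pow, mul_one]
    _ ≤ (networkEnergy G c v)⁻¹ * edgeDist G (absIncr v) A Z ^ 2 := by
      gcongr
      exact one_le_edgeDist_absIncr hA hZ

/-- The `W`-distance from the set `A` to a vertex. [folklore] -/
def distFrom (G : SimpleGraph V) (W : Sym2 V → ℝ≥0) (A : Set V) (x : V) : ℝ≥0∞ :=
  ⨅ (a : V) (_ : a ∈ A) (p : G.Walk a x), (walkLength W p : ℝ≥0∞)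

/-- [folklore] -/
theorem distFrom_eq_zero_of_mem (W : Sym2 V → ℝ≥0) {a : V} (ha : a ∈ A) :
    distFrom G W A a = 0 :=
  le_antisymm (iInf_le_of_le a <| iInf_le_of_le ha <| (iInf_le _ Walk.nil).trans (by simp))
    zero_le

/-- [folklore] -/
theorem edgeDist_le_distFrom (W : Sym2 V → ℝ≥0) {z : V} (hz : z ∈ Z) :
    edgeDist G W A Z ≤ distFrom G W A z :=
  le_iInf fun _ ↦ le_iInf fun ha ↦ le_iInf fun p ↦ edgeDist_le_walkLength W ha hz p

/-- The distance from `A` is `W`-Lipschitz along edges. [folklore] -/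
theorem distFrom_le_distFrom_add (W : Sym2 V → ℝ≥0) {x y : V} (h : G.Adj x y) :
    distFrom G W A y ≤ distFrom G W A x + W s(x, y) := by
  unfold distFrom
  rw [ENNReal.iInf_add]
  refine le_iInf fun a ↦ ?_
  rw [ENNReal.iInf_add]
  refine le_iInf fun ha ↦ ?_
  rw [ENNReal.iInf_add]
  refine le_iInf fun p ↦ ?_
  refine (iInf_le_of_le a <| iInf_le_of_le ha <| iInf_le _ (p.concat h)).trans (le_of_eq ?_)
  rw [walkLength_concat, ENNReal.coe_add]

/-- Truncation `min d (·)` preserves the Lipschitz bound. [folklore] -/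
theorem min_distFrom_le (W : Sym2 V → ℝ≥0) (d : ℝ≥0∞) {x y : V} (h : G.Adj x y) :
    min d (distFrom G W A y) ≤ min d (distFrom G W A x) + W s(x, y) := by
  rcases le_total d (distFrom G W A x) with hd | hd
  · rw [min_eq_left hd]
    exact (min_le_left _ _).trans le_self_add
  · rw [min_eq_right hd]
    exact (min_le_right _ _).trans (distFrom_le_distFrom_add W h)

/-- Duffin's test potential `u(x) = min(d, dist_W(A, x)) / d`, for `d = dist_W(A, Z)`. [folklore] -/
def duffinPotential (G : SimpleGraph V) (W : Sym2 V → ℝ≥0) (A : Set V) (d : ℝ≥0∞) (x : V) : ℝ :=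
  (min d (distFrom G W A x)).toReal / d.toReal

/-- The test potential vanishes on `A`. [folklore] -/
theorem duffinPotential_of_mem_left (W : Sym2 V → ℝ≥0) (d : ℝ≥0∞) {a : V} (ha : a ∈ A) :
    duffinPotential G W A d a = 0 := by
  simp [duffinPotential, distFrom_eq_zero_of_mem W ha]

/-- The test potential is `1` on `Z` when `d = dist_W(A, Z)` is positive and finite. [folklore] -/
theorem duffinPotential_of_mem_right (W : Sym2 V → ℝ≥0) (h0 : edgeDist G W A Z ≠ 0)
    (ht : edgeDist G W A Z ≠ ⊤) {z : V} (hz : z ∈ Z) :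
    duffinPotential G W A (edgeDist G W A Z) z = 1 := by
  rw [duffinPotential, min_eq_left (edgeDist_le_distFrom W hz),
    div_self (ENNReal.toReal_ne_zero.2 ⟨h0, ht⟩)]

/-- The Lipschitz estimate `|u(x) - u(y)| · d ≤ W(xy)` for Duffin's test potential along an
edge. [folklore] -/
theorem abs_sub_duffinPotential_mul_le (W : Sym2 V → ℝ≥0) {d : ℝ≥0∞} (h0 : d ≠ 0) (ht : d ≠ ⊤)
    {x y : V} (h : G.Adj x y) :
    |duffinPotential G W A d x - duffinPotential G W A d y| * d.toReal ≤ W s(x, y) := by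
  have hd : 0 < d.toReal := ENNReal.toReal_pos h0 ht
  set mx := min d (distFrom G W A x) with hmx
  set my := min d (distFrom G W A y) with hmy
  have hmxt : mx ≠ ⊤ := ne_top_of_le_ne_top ht (min_le_left _ _)
  have hmyt : my ≠ ⊤ := ne_top_of_le_ne_top ht (min_le_left _ _)
  have h1 : my.toReal ≤ mx.toReal + W s(x, y) := by
    have := ENNReal.toReal_mono (ENNReal.add_ne_top.2 ⟨hmxt, ENNReal.coe_ne_top⟩)
      (min_distFrom_le (A := A) W d h)
    rwa [ENNReal.toReal_add hmxt ENNReal.coe_ne_top, ENNReal.coe_toReal] at this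
  have h2 : mx.toReal ≤ my.toReal + W s(x, y) := by
    have := ENNReal.toReal_mono (ENNReal.add_ne_top.2 ⟨hmyt, ENNReal.coe_ne_top⟩)
      (min_distFrom_le (A := A) W d h.symm)
    rwa [ENNReal.toReal_add hmyt ENNReal.coe_ne_top, ENNReal.coe_toReal, Sym2.eq_swap] at this
  rw [duffinPotential, duffinPotential, ← hmx, ← hmy, ← sub_div, abs_div, abs_of_pos hd,
    div_mul_cancel₀ _ hd.ne']
  exact abs_sub_le_iff.2 ⟨by linarith, by linarith⟩

/-- Termwise energy bound for Duffin's test potential: `c(e) du(e)² d² ≤ c(e) W(e)²` on edges.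
[folklore] -/
theorem sqIncr_duffinPotential_mul_le (W : Sym2 V → ℝ≥0) {d : ℝ≥0∞} (h0 : d ≠ 0) (ht : d ≠ ⊤)
    {x y : V} (h : G.Adj x y) :
    ENNReal.ofReal (sqIncr (duffinPotential G W A d) s(x, y)) * d ^ 2 ≤ (W s(x, y) : ℝ≥0∞) ^ 2 := by
  have key := abs_sub_duffinPotential_mul_le (A := A) W h0 ht h
  have hsq : (duffinPotential G W A d x - duffinPotential G W A d y) ^ 2 * d.toReal ^ 2 ≤
      (W s(x, y) : ℝ) ^ 2 := by
    have h2 := pow_le_pow_left₀ (by positivity) key 2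
    calc (duffinPotential G W A d x - duffinPotential G W A d y) ^ 2 * d.toReal ^ 2
        = (|duffinPotential G W A d x - duffinPotential G W A d y| * d.toReal) ^ 2 := by
          rw [mul_pow, sq_abs]
      _ ≤ (W s(x, y) : ℝ) ^ 2 := h2
  calc ENNReal.ofReal (sqIncr (duffinPotential G W A d) s(x, y)) * d ^ 2
      = ENNReal.ofReal ((duffinPotential G W A d x - duffinPotential G W A d y) ^ 2 *
          d.toReal ^ 2) := by
        rw [sqIncr_mk, ENNReal.ofReal_mul (sq_nonneg _), ENNReal.ofReal_pow ENNReal.toReal_nonneg,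
          ENNReal.ofReal_toReal ht]
    _ ≤ ENNReal.ofReal ((W s(x, y) : ℝ) ^ 2) := ENNReal.ofReal_le_ofReal hsq
    _ = (W s(x, y) : ℝ≥0∞) ^ 2 := by
        rw [ENNReal.ofReal_pow (NNReal.coe_nonneg _), ENNReal.ofReal_coe_nnreal]

/-- The core of Duffin's theorem: `𝒞(A ↔ Z) · dist_W(A, Z)² ≤ area(W)` for every length
assignment `W`. [cite: LyonsPeres2016, Chapter 2, Additional Exercises, Exercise 2.78 (identity due to Duffin 1962)] -/
theorem effectiveConductance_mul_edgeDist_sq_le (G : SimpleGraph V) (c : Sym2 V → ℝ≥0)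
    (A Z : Set V) (W : Sym2 V → ℝ≥0) :
    effectiveConductance G c A Z * edgeDist G W A Z ^ 2 ≤ networkArea G c W := by
  rcases eq_or_ne (edgeDist G W A Z) 0 with h0 | h0
  · simp [h0]
  rcases eq_or_ne (edgeDist G W A Z) ⊤ with ht | ht
  · -- no walk joins `A` to `Z`
    have hC : effectiveConductance G c A Z = 0 :=
      effectiveConductance_eq_zero_of_not_reachable fun a ha z hz ⟨p⟩ ↦ by
        have hle := edgeDist_le_walkLength W ha hz p
        rw [ht, top_le_iff] at hle
        exact ENNReal.coe_ne_top hle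
    simp [hC]
  -- main case: `1 - duffinPotential` is admissible
  have hA : A.EqOn (fun x ↦ 1 - duffinPotential G W A (edgeDist G W A Z) x) 1 := fun a ha ↦ by
    show 1 - duffinPotential G W A (edgeDist G W A Z) a = 1
    rw [duffinPotential_of_mem_left W _ ha, sub_zero]
  have hZ : Z.EqOn (fun x ↦ 1 - duffinPotential G W A (edgeDist G W A Z) x) 0 := fun z hz ↦ by
    show 1 - duffinPotential G W A (edgeDist G W A Z) z = 0
    rw [duffinPotential_of_mem_right W h0 ht hz, sub_self]
  calc effectiveConductance G c A Z * edgeDist G W A Z ^ 2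
      ≤ networkEnergy G c (fun x ↦ 1 - duffinPotential G W A (edgeDist G W A Z) x) *
          edgeDist G W A Z ^ 2 := by
        gcongr
        exact effectiveConductance_le_networkEnergy hA hZ
    _ = networkEnergy G c (duffinPotential G W A (edgeDist G W A Z)) * edgeDist G W A Z ^ 2 := by
        rw [networkEnergy_const_sub]
    _ = ∑' e, G.edgeSet.indicator
          (fun e ↦ (c e : ℝ≥0∞) * ENNReal.ofReal (sqIncr (duffinPotential G W A (edgeDist G W A Z)) e) *
            edgeDist G W A Z ^ 2) e := by
        rw [networkEnergy, ← ENNReal.tsum_mul_right]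
        refine tsum_congr fun e ↦ ?_
        exact (Set.indicator_mul_left G.edgeSet _ (fun _ ↦ edgeDist G W A Z ^ 2)).symm
    _ ≤ networkArea G c W := ENNReal.tsum_le_tsum fun e ↦ ?_
  refine Sym2.ind (fun x y ↦ ?_) e
  by_cases he : s(x, y) ∈ G.edgeSet
  · rw [Set.indicator_of_mem he, Set.indicator_of_mem he, mul_assoc]
    gcongr
    exact sqIncr_duffinPotential_mul_le W h0 ht ((mem_edgeSet G).1 he)
  · rw [Set.indicator_of_notMem he, Set.indicator_of_notMem he]

/-- An `ℝ≥0∞` rearrangement: `C · d ≤ a` gives `d / a ≤ C⁻¹` (all junk cases included).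
[folklore] -/
theorem ennreal_div_le_inv_of_mul_le {a d C : ℝ≥0∞} (h : C * d ≤ a) : d / a ≤ C⁻¹ := by
  rcases eq_or_ne C 0 with rfl | hC0
  · simp
  rcases eq_or_ne C ⊤ with rfl | hCt
  · rcases eq_or_ne d 0 with rfl | hd
    · simp
    · rw [ENNReal.top_mul hd, top_le_iff] at h
      simp [h]
  · rw [ENNReal.div_le_iff_le_mul (Or.inr (ENNReal.inv_ne_top.2 hC0))
      (Or.inr (ENNReal.inv_ne_zero.2 hCt))]
    calc d = C⁻¹ * (C * d) := by rw [← mul_assoc, ENNReal.inv_mul_cancel hC0 hCt, one_mul]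
      _ ≤ C⁻¹ * a := by gcongr

/-- **Duffin's theorem, hard half**: `EL(A, Z) ≤ ℛ(A ↔ Z)`. [cite: LyonsPeres2016, Chapter 2, Additional Exercises, Exercise 2.78 (identity due to Duffin 1962)] -/
theorem extremalLength_le_effectiveResistance (G : SimpleGraph V) (c : Sym2 V → ℝ≥0)
    (A Z : Set V) : extremalLength G c A Z ≤ effectiveResistance G c A Z :=
  iSup_le fun W ↦
    ennreal_div_le_inv_of_mul_le (effectiveConductance_mul_edgeDist_sq_le G c A Z W)

/-- **Duffin's theorem** (Duffin 1962, "the extremal length of a network equals its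
resistance"; Lyons–Peres 2016, Exercise 2.78): for every network `(G, c)` and all vertex sets
`A, Z`, the discrete extremal length of the paths from `A` to `Z` equals the effective resistance
`ℛ(A ↔ Z)` (here for arbitrary simple graphs, with the `ℝ≥0∞` conventions of this file).
[cite: LyonsPeres2016, Chapter 2, Additional Exercises, Exercise 2.78 (identity due to Duffin 1962)] -/
theorem extremalLength_eq_effectiveResistance (G : SimpleGraph V) (c : Sym2 V → ℝ≥0)
    (A Z : Set V) : extremalLength G c A Z = effectiveResistance G c A Z :=
  le_antisymm (extremalLength_le_effectiveResistance G c A Z)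
    (effectiveResistance_le_extremalLength G c A Z)

/-- **Extremal length, the form printed in Lyons–Peres 2016, Exercise 2.78**:
`𝒞(A ↔ Z) = min Σ_e c(e) ℓ(e)²` over assignments `ℓ ≥ 0` of edge lengths for which the
`ℓ`-distance from `A` to `Z` is at least `1` (Lyons–Peres write "is `1`"; the infimum is the same,
since scaling `ℓ` down to distance exactly `1` only decreases the area — that rescaling is not
formalized here). Here as an infimum in `ℝ≥0∞`, for every simple graph.
[cite: LyonsPeres2016, Chapter 2, Additional Exercises, Exercise 2.78] -/
theorem effectiveConductance_eq_iInf_networkArea (G : SimpleGraph V) (c : Sym2 V → ℝ≥0)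
    (A Z : Set V) :
    effectiveConductance G c A Z =
      ⨅ (ℓ : Sym2 V → ℝ≥0) (_ : 1 ≤ edgeDist G ℓ A Z), networkArea G c ℓ := by
  refine le_antisymm (le_iInf fun ℓ ↦ le_iInf fun hℓ ↦ ?_) ?_
  · calc effectiveConductance G c A Z = effectiveConductance G c A Z * 1 ^ 2 := by
          rw [one_pow, mul_one]
      _ ≤ effectiveConductance G c A Z * edgeDist G ℓ A Z ^ 2 := by gcongr
      _ ≤ networkArea G c ℓ := effectiveConductance_mul_edgeDist_sq_le G c A Z ℓ
  · refine le_effectiveConductance fun v hA hZ ↦ ?_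
    calc ⨅ (ℓ : Sym2 V → ℝ≥0) (_ : 1 ≤ edgeDist G ℓ A Z), networkArea G c ℓ
        ≤ networkArea G c (absIncr v) :=
          iInf_le_of_le (absIncr v) (iInf_le _ (one_le_edgeDist_absIncr hA hZ))
      _ = networkEnergy G c v := networkArea_absIncr G c v

end Duffin

/-! ### The series upper bound `ℛ(A ↔ Z) ≤ Σ_{e ∈ path} r(e)` -/

section Series

variable {G : SimpleGraph V} {c : Sym2 V → ℝ≥0} {A Z : Set V}

/-- `|dv(e)|² = dv(e)²`, real version. [folklore] -/
theorem coe_absIncr_sq_real (v : V → ℝ) (e : Sym2 V) :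
    ((absIncr v e : ℝ≥0) : ℝ) ^ 2 = sqIncr v e :=
  Sym2.ind (fun x y ↦ by rw [coe_absIncr_mk, sq_abs, sqIncr_mk]) e

/-- A finite partial sum of the energy over edges of `G` is at most the energy. [folklore] -/
theorem ofReal_sum_le_networkEnergy (v : V → ℝ) {S : Finset (Sym2 V)}
    (hS : ∀ e ∈ S, e ∈ G.edgeSet) :
    ENNReal.ofReal (∑ e ∈ S, (c e : ℝ) * sqIncr v e) ≤ networkEnergy G c v := by
  rw [ENNReal.ofReal_sum_of_nonneg fun e _ ↦ mul_nonneg (NNReal.coe_nonneg _) (sqIncr_nonneg v e)]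
  refine le_trans (le_of_eq (Finset.sum_congr rfl fun e he ↦ ?_)) (ENNReal.sum_le_tsum S)
  rw [Set.indicator_of_mem (hS e he), ENNReal.ofReal_mul (NNReal.coe_nonneg _),
    ENNReal.ofReal_coe_nnreal]

/-- **Series upper bound** (the trivial half of the series law, valid in any network): if a walk
`p` from `a ∈ A` to `z ∈ Z` uses no edge twice and has positive conductances, then
`ℛ(A ↔ Z) ≤ Σ_{e ∈ p} r(e)` with `r = 1/c`; in particular `ℛ(A ↔ Z) < ⊤` and `𝒞(A ↔ Z) > 0`.
Proof: for an admissible `v`, `1 ≤ Σ_{e ∈ p} |dv(e)| ≤ (Σ_{e ∈ p} r(e))^{1/2} (Σ_{e ∈ p} c(e) dv(e)²)^{1/2}`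
(Cauchy–Schwarz), so `energy(v) ≥ 1 / Σ_{e ∈ p} r(e)`. (Compare Lyons–Peres 2016, §2.3, series
law, and Rayleigh's monotonicity principle, §2.4.) [folklore] -/
theorem effectiveResistance_le_sum_inv {a z : V} (ha : a ∈ A) (hz : z ∈ Z) (p : G.Walk a z)
    (hp : p.edges.Nodup) (hc : ∀ e ∈ p.edges, 0 < c e) [DecidableEq V] :
    effectiveResistance G c A Z ≤ ∑ e ∈ p.edges.toFinset, (c e : ℝ≥0∞)⁻¹ := by
  by_cases hAZ : Disjoint A Z
  swap
  · rw [effectiveResistance_of_not_disjoint hAZ]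
    exact zero_le
  set S := p.edges.toFinset with hS
  have hSE : ∀ e ∈ S, e ∈ G.edgeSet := fun e he ↦
    p.edges_subset_edgeSet (List.mem_toFinset.1 he)
  have hcS : ∀ e ∈ S, (0 : ℝ) < c e := fun e he ↦ by
    exact_mod_cast hc e (List.mem_toFinset.1 he)
  have hSne : S.Nonempty := by
    have haz : a ≠ z := fun h ↦ hAZ.ne_of_mem ha hz h
    cases p with
    | nil => exact absurd rfl haz
    | @cons _ b _ h q => exact ⟨s(a, b), List.mem_toFinset.2 (by simp)⟩
  set Rp : ℝ := ∑ e ∈ S, (c e : ℝ)⁻¹ with hRp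
  have hRp_pos : 0 < Rp := Finset.sum_pos (fun e he ↦ inv_pos.2 (hcS e he)) hSne
  -- the energy of every admissible potential is at least `1 / Rp`
  have key : (ENNReal.ofReal Rp)⁻¹ ≤ effectiveConductance G c A Z := by
    refine le_effectiveConductance fun v hA hZ ↦ ?_
    have h1 : (1 : ℝ) ≤ ∑ e ∈ S, (absIncr v e : ℝ) := by
      have h := abs_sub_le_walkLength_absIncr v p
      rw [hA ha, hZ hz, Pi.one_apply, Pi.zero_apply, sub_zero, abs_one, walkLength,
        ← List.sum_toFinset _ hp] at h
      exact_mod_cast h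
    have hCS : (∑ e ∈ S, (absIncr v e : ℝ)) ^ 2 ≤ Rp * ∑ e ∈ S, (c e : ℝ) * sqIncr v e :=
      -- weighted Cauchy–Schwarz with `|dv(e)|² = r(e) · (c(e) dv(e)²)`
      Finset.sum_sq_le_sum_mul_sum_of_sq_le_mul S (fun e he ↦ (inv_pos.2 (hcS e he)).le)
        (fun e _ ↦ mul_nonneg (NNReal.coe_nonneg _) (sqIncr_nonneg v e)) fun e he ↦ by
          rw [coe_absIncr_sq_real, ← mul_assoc, inv_mul_cancel₀ (hcS e he).ne', one_mul]
    have hT : Rp⁻¹ ≤ ∑ e ∈ S, (c e : ℝ) * sqIncr v e := by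
      rw [inv_le_iff_one_le_mul₀ hRp_pos, mul_comm]
      exact (one_le_pow₀ h1).trans hCS
    calc (ENNReal.ofReal Rp)⁻¹ = ENNReal.ofReal Rp⁻¹ := (ENNReal.ofReal_inv_of_pos hRp_pos).symm
      _ ≤ ENNReal.ofReal (∑ e ∈ S, (c e : ℝ) * sqIncr v e) := ENNReal.ofReal_le_ofReal hT
      _ ≤ networkEnergy G c v := ofReal_sum_le_networkEnergy v hSE
  -- invert
  calc effectiveResistance G c A Z ≤ ((ENNReal.ofReal Rp)⁻¹)⁻¹ := ENNReal.inv_le_inv.2 key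
    _ = ENNReal.ofReal Rp := inv_inv _
    _ = ∑ e ∈ S, (c e : ℝ≥0∞)⁻¹ := by
        rw [hRp, ENNReal.ofReal_sum_of_nonneg fun e he ↦ (inv_pos.2 (hcS e he)).le]
        refine Finset.sum_congr rfl fun e he ↦ ?_
        rw [ENNReal.ofReal_inv_of_pos (hcS e he), ENNReal.ofReal_coe_nnreal]

end Series

/-! ### Kirchhoff's effective resistance formula (one named fact) -/

section Kirchhoff

variable [Fintype V] (G : SimpleGraph V) [DecidableRel G.Adj]

open Classical in
/-- The edge sets of the **spanning trees** of a finite simple graph `G`: subsets `T ⊆ E(G)`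
such that the graph on `V` with edge set `T` is a tree (connected — hence spanning — and
acyclic). [folklore] -/
def spanningTreeEdgeSets : Finset (Finset (Sym2 V)) :=
  G.edgeFinset.powerset.filter fun T ↦ (fromEdgeSet (T : Set (Sym2 V))).IsTree

open Classical in
/-- The edge sets of the **spanning 2-forests separating `x` from `y`**: subsets `F ⊆ E(G)` such
that the graph on `V` with edge set `F` is acyclic, does not join `x` to `y`, and every vertex is
joined to `x` or to `y` (so it has exactly the two components of `x` and of `y`). They count
the spanning trees of `G/{x,y}` (`x` and `y` identified; Bondy–Murty's `t(G/{x,y})`); what is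
proved below is the bijection `F ↦ F + xy` onto the spanning trees through `xy` of `G + xy`
(`card_filter_mem_spanningTreeEdgeSets`). [folklore] -/
def twoForestEdgeSets (x y : V) : Finset (Finset (Sym2 V)) :=
  G.edgeFinset.powerset.filter fun F ↦ (fromEdgeSet (F : Set (Sym2 V))).IsAcyclic ∧
    ¬ (fromEdgeSet (F : Set (Sym2 V))).Reachable x y ∧
    ∀ z, (fromEdgeSet (F : Set (Sym2 V))).Reachable x z ∨ (fromEdgeSet (F : Set (Sym2 V))).Reachable y z

/-- Members of `spanningTreeEdgeSets` are sets of edges of `G`. [folklore] -/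
theorem subset_of_mem_spanningTreeEdgeSets {T : Finset (Sym2 V)} (h : T ∈ spanningTreeEdgeSets G) :
    T ⊆ G.edgeFinset := by
  classical
  exact Finset.mem_powerset.1 (Finset.mem_filter.1 h).1

/-- Members of `twoForestEdgeSets` are sets of edges of `G`. [folklore] -/
theorem subset_of_mem_twoForestEdgeSets {x y : V} {F : Finset (Sym2 V)}
    (h : F ∈ twoForestEdgeSets G x y) : F ⊆ G.edgeFinset := by
  classical
  exact Finset.mem_powerset.1 (Finset.mem_filter.1 h).1

end Kirchhoff

/-- **Kirchhoff's effective resistance formula** (Kirchhoff 1847; Lyons–Peres 2016, §4.2):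
for a finite connected network `(G, c)` with positive conductances and an edge `e = xy` of `G`,
`P[e ∈ T] = c(e) ℛ(x ↔ y)`, where `T` is the weighted uniform spanning tree,
`P[T = t] ∝ Π_{f ∈ t} c(f)` (Lyons–Peres 2016, §4.1). Written out, the probability on the left
is the ratio `Σ_{t ∋ e} Π_{f ∈ t} c(f) / Σ_t Π_{f ∈ t} c(f)` over the spanning trees `t` of `G`.
Not proved here (it needs the matrix–tree theorem or Wilson's algorithm).
[cite: LyonsPeres2016, §4.2 (Electrical Interpretations), Kirchhoff's Effective Resistance Formula] -/
def KirchhoffEdgeFormula : Prop :=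
  ∀ (V : Type) [Fintype V] [DecidableEq V] (G : SimpleGraph V) [DecidableRel G.Adj]
    (c : Sym2 V → ℝ≥0), G.Connected → (∀ e ∈ G.edgeSet, 0 < c e) → ∀ x y : V, G.Adj x y →
      (((∑ t ∈ (spanningTreeEdgeSets G).filter (fun t ↦ s(x, y) ∈ t), ∏ f ∈ t, c f : ℝ≥0) :
          ℝ≥0∞) / ((∑ t ∈ spanningTreeEdgeSets G, ∏ f ∈ t, c f : ℝ≥0) : ℝ≥0∞)
        = c s(x, y) * effectiveResistance G c {x} {y})

/-! ### The forest-ratio formula follows from the edge formula -/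

section ForestRatio

variable {x y : V}

/-- Along a walk of `H ⊔ edge x y` ending at `x`, every vertex is `H`-reachable from `x` or from
`y`. [folklore] -/
theorem reachable_or_of_walk_sup_edge {H : SimpleGraph V} :
    ∀ {u w : V} (_ : (H ⊔ edge x y).Walk u w), w = x → H.Reachable x u ∨ H.Reachable y u := by
  intro u w p
  induction p with
  | nil => rintro rfl; exact Or.inl (Reachable.refl _)
  | @cons a b _ hab _ ih =>
    intro hw
    rcases (sup_adj _ _ _ _).1 hab with h | h
    · rcases ih hw with hb | hb
      · exact Or.inl (hb.trans h.symm.reachable)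
      · exact Or.inr (hb.trans h.symm.reachable)
    · rcases ((edge_adj _ _ _ _).1 h).1 with ⟨rfl, -⟩ | ⟨rfl, -⟩
      · exact Or.inl (Reachable.refl _)
      · exact Or.inr (Reachable.refl _)

/-- Adding the edge `xy` to the edge set `F ∌ xy` produces a (spanning) tree iff `F` is a spanning
2-forest separating `x` from `y`. [folklore] -/
theorem isTree_fromEdgeSet_insert_iff (hxy : x ≠ y) {F : Set (Sym2 V)} (hF : s(x, y) ∉ F) :
    (fromEdgeSet (insert s(x, y) F)).IsTree ↔
      (fromEdgeSet F).IsAcyclic ∧ ¬ (fromEdgeSet F).Reachable x y ∧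
        ∀ z, (fromEdgeSet F).Reachable x z ∨ (fromEdgeSet F).Reachable y z := by
  have hsup : fromEdgeSet (insert s(x, y) F) = fromEdgeSet F ⊔ edge x y := by
    rw [Set.insert_eq, fromEdgeSet_union, sup_comm]
    rfl
  rw [hsup]
  have hexy : (fromEdgeSet F ⊔ edge x y).Adj x y :=
    (sup_adj _ _ _ _).2 (Or.inr ((edge_adj _ _ _ _).2 ⟨Or.inl ⟨rfl, rfl⟩, hxy⟩))
  constructor
  · intro hT
    refine ⟨hT.isAcyclic.anti le_sup_left, ?_, fun z ↦ ?_⟩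
    · -- the new edge is a bridge of the tree
      have hb := isAcyclic_iff_forall_isBridge.1 hT.isAcyclic ((mem_edgeSet _).2 hexy)
      rw [isBridge_iff] at hb
      refine fun hr ↦ hb (hr.mono fun u v huv ↦ ?_)
      refine (deleteEdges_adj ..).2 ⟨(sup_adj _ _ _ _).2 (Or.inl huv), fun he ↦ hF ?_⟩
      rw [Set.mem_singleton_iff] at he
      rw [← he]
      exact ((fromEdgeSet_adj _).1 huv).1
    · obtain ⟨p⟩ := hT.connected.preconnected z x
      exact reachable_or_of_walk_sup_edge p rfl
  · rintro ⟨hacyc, hnr, hcov⟩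
    have hreach : ∀ z, (fromEdgeSet F ⊔ edge x y).Reachable x z := fun z ↦ by
      rcases hcov z with h | h
      · exact h.mono le_sup_left
      · exact hexy.reachable.trans (h.mono le_sup_left)
    haveI : Nonempty V := ⟨x⟩
    exact ⟨(connected_iff _).2 ⟨fun u v ↦ (hreach u).symm.trans (hreach v), ‹_›⟩,
      hacyc.sup_edge_of_not_reachable hnr⟩

variable [Fintype V] [DecidableEq V] {G G' : SimpleGraph V} [DecidableRel G.Adj]
  [DecidableRel G'.Adj]

omit [DecidableEq V] in
/-- Unfolding `spanningTreeEdgeSets`. [folklore] -/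
theorem mem_spanningTreeEdgeSets_iff {T : Finset (Sym2 V)} :
    T ∈ spanningTreeEdgeSets G ↔ T ⊆ G.edgeFinset ∧ (fromEdgeSet (T : Set (Sym2 V))).IsTree := by
  classical
  simp only [spanningTreeEdgeSets, Finset.mem_filter, Finset.mem_powerset]

omit [DecidableEq V] in
/-- Unfolding `twoForestEdgeSets`. [folklore] -/
theorem mem_twoForestEdgeSets_iff {F : Finset (Sym2 V)} :
    F ∈ twoForestEdgeSets G x y ↔ F ⊆ G.edgeFinset ∧
      (fromEdgeSet (F : Set (Sym2 V))).IsAcyclic ∧ ¬ (fromEdgeSet (F : Set (Sym2 V))).Reachable x y ∧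
      ∀ z, (fromEdgeSet (F : Set (Sym2 V))).Reachable x z ∨
        (fromEdgeSet (F : Set (Sym2 V))).Reachable y z := by
  classical
  simp only [twoForestEdgeSets, Finset.mem_filter, Finset.mem_powerset]

/-- The spanning trees of `G + xy` through `xy` are in bijection with the spanning 2-forests of
`G` separating `x` from `y` (`T ↦ T - xy`). [folklore] -/
theorem card_filter_mem_spanningTreeEdgeSets (hxy : x ≠ y)
    (hE : G'.edgeFinset = insert s(x, y) G.edgeFinset) :
    ((spanningTreeEdgeSets G').filter fun T ↦ s(x, y) ∈ T).card =
      (twoForestEdgeSets G x y).card := by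
  refine Finset.card_nbij' (fun T ↦ T.erase s(x, y)) (fun F ↦ insert s(x, y) F) ?_ ?_ ?_ ?_
  · intro T hT
    rw [Finset.mem_coe, Finset.mem_filter, mem_spanningTreeEdgeSets_iff] at hT
    obtain ⟨⟨hTE, htree⟩, hmem⟩ := hT
    have hins : ((T : Set (Sym2 V))) = insert s(x, y) ((T.erase s(x, y) : Finset _) : Set (Sym2 V)) := by
      rw [Finset.coe_erase, Set.insert_sdiff_singleton, Set.insert_eq_of_mem (Finset.mem_coe.2 hmem)]
    have hnot : s(x, y) ∉ ((T.erase s(x, y) : Finset _) : Set (Sym2 V)) := by simp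
    rw [hins, isTree_fromEdgeSet_insert_iff hxy hnot] at htree
    rw [Finset.mem_coe, mem_twoForestEdgeSets_iff]
    refine ⟨fun e he ↦ ?_, htree⟩
    rw [Finset.mem_erase] at he
    have := hTE he.2
    rw [hE, Finset.mem_insert] at this
    exact this.resolve_left he.1
  · intro F hF
    rw [Finset.mem_coe, mem_twoForestEdgeSets_iff] at hF
    obtain ⟨hFE, hacyc, hnr, hcov⟩ := hF
    have hnot : s(x, y) ∉ F := fun h ↦
      hnr ((fromEdgeSet_adj _).2 ⟨Finset.mem_coe.2 h, hxy⟩).reachable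
    rw [Finset.mem_coe, Finset.mem_filter, mem_spanningTreeEdgeSets_iff]
    refine ⟨⟨?_, ?_⟩, Finset.mem_insert_self _ _⟩
    · rw [hE]
      exact Finset.insert_subset_insert _ hFE
    · rw [Finset.coe_insert, isTree_fromEdgeSet_insert_iff hxy (by simpa using hnot)]
      exact ⟨hacyc, hnr, hcov⟩
  · intro T hT
    rw [Finset.mem_coe, Finset.mem_filter] at hT
    exact Finset.insert_erase hT.2
  · intro F hF
    rw [Finset.mem_coe, mem_twoForestEdgeSets_iff] at hF
    obtain ⟨-, -, hnr, -⟩ := hF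
    have hnot : s(x, y) ∉ F := fun h ↦
      hnr ((fromEdgeSet_adj _).2 ⟨Finset.mem_coe.2 h, hxy⟩).reachable
    exact Finset.erase_insert hnot

/-- The spanning trees avoiding `xy` are the same in `G` and in `G + xy`. [folklore] -/
theorem filter_notMem_spanningTreeEdgeSets (hE : G'.edgeFinset = insert s(x, y) G.edgeFinset) :
    ((spanningTreeEdgeSets G').filter fun T ↦ s(x, y) ∉ T) =
      (spanningTreeEdgeSets G).filter fun T ↦ s(x, y) ∉ T := by
  ext T
  simp only [Finset.mem_filter, mem_spanningTreeEdgeSets_iff, hE]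
  constructor
  · rintro ⟨⟨h1, h2⟩, h3⟩
    exact ⟨⟨(Finset.subset_insert_iff_of_notMem h3).1 h1, h2⟩, h3⟩
  · rintro ⟨⟨h1, h2⟩, h3⟩
    exact ⟨⟨h1.trans (Finset.subset_insert _ _), h2⟩, h3⟩

omit [DecidableRel G'.Adj] in
/-- If `xy` is not an edge of `G`, no spanning tree of `G` contains it. [folklore] -/
theorem filter_mem_spanningTreeEdgeSets_of_not_adj (h : ¬ G.Adj x y) :
    ((spanningTreeEdgeSets G).filter fun T ↦ s(x, y) ∈ T) = ∅ := by
  refine Finset.filter_eq_empty_iff.2 fun T hT hmem ↦ h ?_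
  exact (mem_edgeFinset.1 ((mem_spanningTreeEdgeSets_iff.1 hT).1 hmem) : s(x, y) ∈ G.edgeSet)

omit [Fintype V] [DecidableRel G.Adj] [DecidableRel G'.Adj] in
/-- Energy of `G` with a unit conductor added between `x` and `y` (in parallel if `xy ∈ E(G)`).
[folklore] -/
theorem networkEnergy_add_unit_conductor (hE' : G'.edgeSet = insert s(x, y) G.edgeSet)
    (κ : ℝ≥0) (hκ : (κ : ℝ≥0∞) = G.edgeSet.indicator 1 s(x, y) + 1) (v : V → ℝ) :
    networkEnergy G' (fun e ↦ if e = s(x, y) then κ else 1) v =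
      networkEnergy G 1 v + ENNReal.ofReal ((v x - v y) ^ 2) := by
  have hmem : s(x, y) ∈ G'.edgeSet := by rw [hE']; exact Set.mem_insert _ _
  have hg : ∑' e : Sym2 V, (if e = s(x, y) then ENNReal.ofReal ((v x - v y) ^ 2) else 0) =
      ENNReal.ofReal ((v x - v y) ^ 2) :=
    tsum_ite_eq s(x, y) (fun _ ↦ ENNReal.ofReal ((v x - v y) ^ 2))
  rw [networkEnergy, networkEnergy, ← hg, ← ENNReal.tsum_add]
  refine tsum_congr fun e ↦ ?_
  by_cases he : e = s(x, y)
  · subst he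
    rw [if_pos rfl, Set.indicator_of_mem hmem, if_pos rfl, hκ, sqIncr_mk, add_mul, one_mul]
    congr 1
    by_cases heG : s(x, y) ∈ G.edgeSet
    · rw [Set.indicator_of_mem heG, Set.indicator_of_mem heG, Pi.one_apply, Pi.one_apply,
        ENNReal.coe_one, sqIncr_mk]
    · rw [Set.indicator_of_notMem heG, Set.indicator_of_notMem heG, zero_mul]
  · rw [if_neg he, add_zero]
    have hiff : e ∈ G'.edgeSet ↔ e ∈ G.edgeSet := by
      rw [hE', Set.mem_insert_iff, or_iff_right he]
    by_cases heG : e ∈ G.edgeSet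
    · rw [Set.indicator_of_mem (hiff.2 heG), Set.indicator_of_mem heG, if_neg he, Pi.one_apply]
    · rw [Set.indicator_of_notMem heG, Set.indicator_of_notMem (mt hiff.1 heG)]

omit [Fintype V] [DecidableRel G.Adj] [DecidableRel G'.Adj] in
/-- Adding a unit conductor between `x` and `y` adds `1` to `𝒞(x ↔ y)` (a parallel law).
[folklore] -/
theorem effectiveConductance_add_unit_conductor (hE' : G'.edgeSet = insert s(x, y) G.edgeSet)
    (κ : ℝ≥0) (hκ : (κ : ℝ≥0∞) = G.edgeSet.indicator 1 s(x, y) + 1) :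
    effectiveConductance G' (fun e ↦ if e = s(x, y) then κ else 1) {x} {y} =
      effectiveConductance G 1 {x} {y} + 1 := by
  simp only [effectiveConductance, networkEnergy_add_unit_conductor hE' κ hκ]
  rw [ENNReal.iInf_add]
  refine iInf_congr fun v ↦ ?_
  rw [ENNReal.iInf_add]
  refine iInf_congr fun hA ↦ ?_
  rw [ENNReal.iInf_add]
  refine iInf_congr fun hZ ↦ ?_
  rw [hA rfl, hZ rfl, Pi.one_apply, Pi.zero_apply, sub_zero, one_pow, ENNReal.ofReal_one]

omit [DecidableEq V] [DecidableRel G'.Adj] in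
/-- `𝒞(x ↔ y)` is finite on a finite graph when `x ≠ y`. [folklore] -/
theorem effectiveConductance_singleton_ne_top (c : Sym2 V → ℝ≥0) (hxy : x ≠ y) :
    effectiveConductance G c {x} {y} ≠ ⊤ := by
  classical
  refine ne_top_of_le_ne_top (networkEnergy_lt_top G c fun z ↦ if z = x then 1 else 0).ne
    (effectiveConductance_le_networkEnergy (fun z hz ↦ ?_) (fun z hz ↦ ?_))
  · rw [Set.mem_singleton_iff.1 hz]; simp
  · rw [Set.mem_singleton_iff.1 hz]; simp [hxy.symm]

end ForestRatio

/-- **Effective resistance as a ratio of tree counts** (the classical corollary of Kirchhoff's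
formula; Bondy–Murty 2008, Theorem 20.22 and the display `r_xy = t(G/{x,y}) / t(G)` in its
proof): in a finite connected graph with unit conductances, for `x ≠ y`,
`ℛ(x ↔ y) = #{spanning 2-forests separating x from y} / #{spanning trees}` (the spanning trees
of `G/{x,y}` are the separating 2-forests of `G`). Derived here from `KirchhoffEdgeFormula`
exactly as in that proof: adjoin an auxiliary unit conductor between `x` and `y` (in parallel if
`xy` is already an edge), apply the edge formula to it, and count.
[cite: BondyMurty2008, Chapter 20, Theorem 20.22 and its proof] -/
theorem KirchhoffEdgeFormula.forestRatio (h : KirchhoffEdgeFormula) (V : Type) [Fintype V]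
    (G : SimpleGraph V) [DecidableRel G.Adj] (hG : G.Connected) (x y : V) (hxy : x ≠ y) :
    effectiveResistance G 1 {x} {y} =
      ((twoForestEdgeSets G x y).card : ℝ≥0∞) / ((spanningTreeEdgeSets G).card : ℝ≥0∞) := by
  classical
  -- the auxiliary network
  obtain ⟨G', hG'⟩ : ∃ G' : SimpleGraph V, G' = G ⊔ edge x y := ⟨_, rfl⟩
  set κ : ℝ≥0 := if G.Adj x y then 2 else 1 with hκdef
  set c' : Sym2 V → ℝ≥0 := fun e ↦ if e = s(x, y) then κ else 1 with hc'
  have hE' : G'.edgeSet = insert s(x, y) G.edgeSet := by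
    rw [hG', edgeSet_sup, edgeSet_edge_of_ne hxy, Set.union_singleton]
  have hE : G'.edgeFinset = insert s(x, y) G.edgeFinset := by
    ext e
    rw [mem_edgeFinset, hE', Finset.mem_insert, mem_edgeFinset, Set.mem_insert_iff]
  have hκ : (κ : ℝ≥0∞) = G.edgeSet.indicator 1 s(x, y) + 1 := by
    by_cases ha : G.Adj x y
    · rw [hκdef, if_pos ha, Set.indicator_of_mem ((mem_edgeSet G).2 ha), Pi.one_apply]
      norm_num
    · rw [hκdef, if_neg ha, Set.indicator_of_notMem (fun h' ↦ ha ((mem_edgeSet G).1 h'))]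
      norm_num
  have hconn : G'.Connected := by
    rw [hG']
    exact hG.mono le_sup_left
  have hpos : ∀ e ∈ G'.edgeSet, 0 < c' e := fun e _ ↦ by
    simp only [hc', hκdef]; split_ifs <;> norm_num
  have hadj : G'.Adj x y := by
    rw [hG']
    exact (sup_adj _ _ _ _).2 (Or.inr ((edge_adj _ _ _ _).2 ⟨Or.inl ⟨rfl, rfl⟩, hxy⟩))
  have key := h V G' c' hconn hpos x y hadj
  -- evaluate the tree weights
  have hw : ∀ T : Finset (Sym2 V), ∏ f ∈ T, c' f = if s(x, y) ∈ T then κ else 1 := fun T ↦ by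
    simp only [hc']
    exact Finset.prod_ite_eq' T s(x, y) (fun _ ↦ κ)
  set M := ((spanningTreeEdgeSets G').filter fun T ↦ s(x, y) ∈ T).card with hM
  set L := ((spanningTreeEdgeSets G').filter fun T ↦ s(x, y) ∉ T).card with hL
  have hnum : (∑ T ∈ (spanningTreeEdgeSets G').filter (fun T ↦ s(x, y) ∈ T), ∏ f ∈ T, c' f) =
      (M : ℝ≥0) * κ := by
    rw [Finset.sum_congr rfl fun T hT ↦ by rw [hw, if_pos (Finset.mem_filter.1 hT).2],
      Finset.sum_const, nsmul_eq_mul]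
  have hden : (∑ T ∈ spanningTreeEdgeSets G', ∏ f ∈ T, c' f) = (M : ℝ≥0) * κ + L := by
    simp_rw [hw]
    rw [Finset.sum_ite, Finset.sum_const, Finset.sum_const, nsmul_eq_mul, nsmul_eq_mul, mul_one]
  have hc'xy : c' s(x, y) = κ := by simp [hc']
  have hR : effectiveResistance G' c' {x} {y} = (effectiveConductance G 1 {x} {y} + 1)⁻¹ := by
    rw [effectiveResistance_def, hc', effectiveConductance_add_unit_conductor hE' κ hκ]
  rw [hnum, hden, hc'xy, hR] at key
  -- counting identities
  have hF : (twoForestEdgeSets G x y).card = M :=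
    (card_filter_mem_spanningTreeEdgeSets hxy hE).symm
  have hTG : ((spanningTreeEdgeSets G).card : ℝ) = L + ((κ : ℝ) - 1) * M := by
    have hsplit := Finset.card_filter_add_card_filter_not (s := spanningTreeEdgeSets G)
      (fun T ↦ s(x, y) ∈ T)
    have hL' : ((spanningTreeEdgeSets G).filter fun T ↦ s(x, y) ∉ T).card = L := by
      rw [hL, filter_notMem_spanningTreeEdgeSets hE]
    by_cases ha : G.Adj x y
    · have hEq : G'.edgeFinset = G.edgeFinset := by
        rw [hE, Finset.insert_eq_of_mem (mem_edgeFinset.2 ((mem_edgeSet G).2 ha))]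
      have hST : spanningTreeEdgeSets G' = spanningTreeEdgeSets G := by
        ext T
        rw [mem_spanningTreeEdgeSets_iff, mem_spanningTreeEdgeSets_iff, hEq]
      have hM' : ((spanningTreeEdgeSets G).filter fun T ↦ s(x, y) ∈ T).card = M := by
        rw [hM, hST]
      rw [← hsplit, hL', hM', hκdef, if_pos ha]
      push_cast
      ring
    · rw [← hsplit, hL', filter_mem_spanningTreeEdgeSets_of_not_adj ha, Finset.card_empty, hκdef,
        if_neg ha]
      push_cast
      ring
  -- pass to real numbers
  set C := effectiveConductance G 1 {x} {y} with hC
  have hCt : C ≠ ⊤ := effectiveConductance_singleton_ne_top 1 hxy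
  have hk : (0 : ℝ) < κ := by
    rw [hκdef]
    split_ifs <;> norm_num
  have key2 := congrArg ENNReal.toReal key
  rw [ENNReal.toReal_div, ENNReal.coe_toReal, ENNReal.coe_toReal, ENNReal.toReal_mul,
    ENNReal.coe_toReal, ENNReal.toReal_inv, ENNReal.toReal_add hCt ENNReal.one_ne_top,
    ENNReal.toReal_one, NNReal.coe_add, NNReal.coe_mul, NNReal.coe_natCast,
    NNReal.coe_natCast] at key2
  -- key2 : M κ / (M κ + L) = κ (c + 1)⁻¹
  have hc0 : 0 ≤ C.toReal := ENNReal.toReal_nonneg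
  have hMpos : (0 : ℝ) < M := by
    rcases Nat.eq_zero_or_pos M with hM0 | hM0
    · exfalso
      rw [hM0, Nat.cast_zero, zero_mul, zero_div] at key2
      have : (0 : ℝ) < κ * (C.toReal + 1)⁻¹ := by positivity
      linarith
    · exact_mod_cast hM0
  have hden_pos : (0 : ℝ) < M * κ + L := by positivity
  have hmain : (M : ℝ) * C.toReal = (spanningTreeEdgeSets G).card := by
    rw [hTG]
    rw [div_eq_iff hden_pos.ne'] at key2
    have h1 : (C.toReal + 1) ≠ 0 := by positivity
    field_simp at key2
    nlinarith [key2, hk]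
  -- conclude in `ℝ≥0∞`
  have hCeq : C = ((spanningTreeEdgeSets G).card : ℝ≥0∞) / (M : ℝ≥0∞) := by
    have hne : ((spanningTreeEdgeSets G).card : ℝ≥0∞) / (M : ℝ≥0∞) ≠ ⊤ :=
      ENNReal.div_ne_top (ENNReal.natCast_ne_top _) (by exact_mod_cast hMpos.ne')
    rw [← ENNReal.toReal_eq_toReal_iff' hCt hne, ENNReal.toReal_div, ENNReal.toReal_natCast,
      ENNReal.toReal_natCast, eq_div_iff hMpos.ne', mul_comm]
    exact hmain
  rw [hF, effectiveResistance_def, ← hC, hCeq,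
    ENNReal.inv_div (Or.inr (ENNReal.natCast_ne_top _)) (Or.inl (by exact_mod_cast hMpos.ne'))]

end

end Literature.Probability.LatticeModels
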